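import Literature.NumberTheory.Automorphic.Liu2021.LemD1AsPrintedIndexedNonVacuityDetLineDecision
import Literature.NumberTheory.Automorphic.UnitaryRankThreeDiagonal
import Literature.NumberTheory.Automorphic.UnitaryGroupNonsplitPlace
import Literature.NumberTheory.QuadraticForms.HermitianLocalIsotropy
import Literature.NumberTheory.QuadraticForms.LandherrHermitianMatricesDiagonalize
import HarnessLib

/-!
# [Liu2021, App. D Lemma D.1 (3)] bookkeeping — rank `3`: NO CARRIER CHARACTER AT ALL where no det-line carrier exists;
# THE CHARACTER DECISION at every finite place (`SU(V)(F_v) ≤ ker` of every character, Dieudonné II §5)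

Reproduction ∕ bookkeeping (Literature, THEOREMS ONLY: no definition, no record, no named fact, no `sorry`; nothing is
asserted about Liu's oscillator representations or about the tree's constructed local Weil carriers).

✔ `…DetLineDecision.exists_character_trivial_on_detOne_iff` left exactly one statement between the lineage's det-line
picture and «no carrier CHARACTER at all» at the places of the conjunction: «every character of `U(V)(F_v)` kills
`SU(V)(F_v) = {det = 1}`».  For the END's rank `N = 3` the tree HAS this statement — the rank-3 engine
✔ `Automorphic/UnitaryRankThreeDiagonal` (`UnitaryRankThree.apply_eq_one_of_det_eq_one_diagonal'`: for a diagonal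
isotropic hermitian form over a FIELD with involution every homomorphism of its unitary group to a commutative group kills the
determinant-one elements, [Dieudonne1971GroupesClassiques, Chap. II §5] via an explicit Witt frame), the local isotropy of diagonal
hermitian forms of rank `≥ 3` ✔ `QuadraticForms/HermitianLocalIsotropy` (`HermitianLocal.exists_isotropic_localRing`, Jacobson's trace
form + O'Meara 63:19), the field structure of `E ⊗_F F_v` at a non-split place ✔ `UnitaryGroupNonsplitPlace`
(`LocalRing.isField_of_smul_eq`), and for the CM rows the diagonalisation of hermitian matrices ✔ `QuadraticForms/LandherrHermitianMatricesDiagonalize`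
(`Landherr.exists_congr_diagonal`) with the transport ✔ `UnitaryRankThree.apply_eq_one_of_det_eq_one_of_formCongr` — the pattern of
✔ `UnitaryGroupAdelicCharactersDet.localPi_apply_eq_one`.  THIS FILE assembles them on the place model `S = LemD1OfPlace.standingData`:

* §1 **`apply_eq_one_of_det_eq_one_of_diagonal`** — ANY quadratic `E/F`, `J = diagonal d` (`c dᵢ = dᵢ ≠ 0`), rank `3`, NON-SPLIT `w ∣ v`
  (`c • w = w`): every `Ψ : U(V)(F_v) →* ℂˣ` kills `{g : det g = 1}` (`S.U` and the tree's `UnitaryGroup.«local»` have the same members,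
  ✔ `LemD1OfPlace.mem_U_iff`).
* §2 **`apply_eq_one_of_det_eq_one_of_isCMField`** — the CM rows (`L` CM, `F = L⁺`), ANY hermitian non-degenerate `J₃` over `L`,
  every non-split place: the same (Landherr congruence `ᵗḠ J₃ G = diag d` over `L`, read in `L ⊗ L⁺_v`).
* §3 **THE CHARACTER DECISION, rank 3** — **`eq_one_of_forall_scalar_eq_one_…`**: at a non-split place `w ∤ 3` which is ramified over `v` or
  has `3 ∤ q_v + 1`, EVERY character of `U(V)(F_v)` trivial on the centre `E_v¹` is TRIVIAL (no one-dimensional carrier with trivial central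
  character whatsoever — not merely no det-line one), and two characters with the same central character are EQUAL
  (**`eq_of_forall_scalar_eq_…`**: no two-member LINE-carrier model with equal `χ`-labels separates anything there); and the iff at
  EVERY finite place: **`exists_character_trivial_on_center_iff_…`** — «∃ Ψ : U(V)(F_v) →* ℂˣ, `Ψ ∘ S.scalar = 1`, `Ψ ≠ 1`» ⟺
  ¬(`c • w = w` ∧ `v_w(3) = 1` ∧ (`e(w|v) ≠ 1` ∨ `3 ∤ q_v + 1`)) (✔ `…DetLineDecision` for «⟸» and for `E_v¹ = (E_v¹)³`).
  Diagonal `J` for any `E/F`; any `J₃` for the CM rows — in particular THE END's `N = 3`.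

What this does NOT give: ranks `N ≠ 3` (the tree's engine is rank `3`; `N ≥ 4` would need the general Dieudonné theorem); carriers of
dimension `> 1`; the rows' OWN carriers `𝓢.omegaLoc v`; Lem. D.1 itself.  HC_CM is NOT proved.

Cell pub-hodgecm2 (COR-CM), audit class of the END rows `hD1''` ∕ `hD3`; seat prover-pub-hodgecm2-b10.

References: [Liu2021] Y. Liu, *Fourier–Jacobi cycles and arithmetic relative trace formula*, Camb. J. Math. 9 (2021) =
arXiv:2102.11518, App. D §D.1 (l. 5213–5221), Lemma D.1 (3) (l. 5233); [Dieudonne1971GroupesClassiques] J. Dieudonné, *La géométrie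
des groupes classiques*, 3e éd. (1971), Chap. II §§4–5; [Jacobson1940HermitianForms] N. Jacobson, Bull. AMS 46 (1940), §3 (1)(a);
[Omeara1963] O. T. O'Meara, *Introduction to Quadratic Forms* (1963), §63C Prop. 63:19; [Landherr1936HermitianForms] W. Landherr, Abh. Math.
Sem. Hamburg 11 (1936); [Mok2014] C. P. Mok, Mem. AMS 235 (2015), §1 Notation p. 5; [NeukirchANT1999] Ch. II §5 Prop. (5.3).
-/

noncomputable section

open scoped Matrix MatrixGroups
open NumberField IsDedekindDomain
open Literature.RepresentationTheory
open Literature.RepresentationTheory.Liu2021 (OscillatorStandingData)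
open Literature.NumberTheory.GaloisRepresentations (HeckeCharacter)
open Literature.NumberTheory.QuadraticForms (HermitianLocal.exists_isotropic_localRing)

namespace Literature.NumberTheory.Automorphic.Liu2021.LemD1IndexedNonVacuityCharacterDecision

open UnitaryGroup

/-! ## §0 Transport of `SU ≤ ker` along an equality of subgroups -/

/-- If `S = T` as subgroups and every hom on `T` kills the elements satisfying `P`, so does every hom on `S`
(copy of the private lemma of ✔ `UnitaryGroupAdelicCharactersDet`). [folklore] -/
private theorem kills_of_eq {G A : Type*} [Group G] [CommGroup A] {S T : Subgroup G} (e : S = T) (P : G → Prop)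
    (hT : ∀ (θ' : ↥T →* A) (y : ↥T), P y.1 → θ' y = 1) (θ : ↥S →* A) (x : ↥S) (hx : P x.1) : θ x = 1 := by
  subst e
  exact hT θ x hx

/-! ## §1 ANY quadratic `E/F`, DIAGONAL `J` of rank `3`, NON-SPLIT place: every character of `U(V)(F_v)` kills `{det = 1}` -/

section Diagonal

variable {F : Type} (E : Type) [Field F] [NumberField F] [Field E] [NumberField E] [Algebra F E]
  [Algebra.IsQuadraticExtension F E] (v : HeightOneSpectrum (𝓞 F)) (c : E ≃ₐ[F] E)
  {δ : E} (hcδ : c δ = -δ) (hδ : δ ≠ 0)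
  (d : Fin 3 → E) (hJh : ((Matrix.diagonal d).map c)ᵀ = Matrix.diagonal d) (hJdet : (Matrix.diagonal d).det ≠ 0)

omit [NumberField F] [Algebra.IsQuadraticExtension F E] in
include hcδ hδ in
/-- `c ≠ 1` (`c δ = −δ ≠ δ`); copy of the siblings' private lemma. [folklore] -/
private theorem hc_of_delta : c ≠ 1 := by
  rintro rfl
  rw [AlgEquiv.one_apply] at hcδ
  have h2 : (2 : E) * δ = 0 := by linear_combination hcδ
  exact hδ ((mul_eq_zero.mp h2).resolve_left two_ne_zero)

omit [NumberField F] [NumberField E] [Algebra.IsQuadraticExtension F E] in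
include hJh in
/-- the diagonal entries of a hermitian diagonal matrix are `c`-fixed. [folklore] -/
private theorem apply_diag_eq (i : Fin 3) : c (d i) = d i := by
  have h := congrFun (congrFun hJh i) i
  rwa [Matrix.transpose_apply, Matrix.map_apply, Matrix.diagonal_apply_eq] at h

omit [NumberField F] [NumberField E] [Algebra.IsQuadraticExtension F E] [Algebra F E] in
include hJdet in
/-- the diagonal entries of a non-degenerate diagonal matrix are non-zero. [folklore] -/
private theorem diag_ne_zero (i : Fin 3) : d i ≠ 0 := by
  rw [Matrix.det_diagonal] at hJdet
  exact (Finset.prod_ne_zero_iff.1 hJdet) i (Finset.mem_univ i)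

include hcδ hJh hJdet in
/-- **Rank 3, diagonal `J`, NON-SPLIT place: every character of `U(V)(F_v)` kills the determinant-one subgroup `SU(V)(F_v)`.**
At a non-split `v` the ring `E_v = E ⊗_F F_v` is a FIELD (✔ `LocalRing.isField_of_smul_eq`) with the involution `c ⊗ 1`, the form
`J ⊗ 1 = diagonal(dᵢ ⊗ 1)` is isotropic there (rank `3`, ✔ `HermitianLocal.exists_isotropic_localRing`), so the tree's rank-3 engine
✔ `UnitaryRankThree.apply_eq_one_of_det_eq_one_diagonal'` applies to `UnitaryGroup.«local» E c 3 J v`, which has the same members as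
`S.U` (✔ `LemD1OfPlace.mem_U_iff`). [cite: Dieudonne1971GroupesClassiques, Chap. II §5] [cite: Jacobson1940HermitianForms, §3 (1)(a)]
[cite: Liu2021, App. D §D.1 Step 3 (l. 5221)] -/
theorem apply_eq_one_of_det_eq_one_of_diagonal (w : PlacesOver E v) (hw : c • w.1 = w.1)
    (Ψ : (LemD1OfPlace.standingData E v c 3 (Matrix.diagonal d) hcδ hδ (by norm_num) hJh hJdet).U →* ℂˣ)
    (g : (LemD1OfPlace.standingData E v c 3 (Matrix.diagonal d) hcδ hδ (by norm_num) hJh hJdet).U)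
    (hg : Matrix.GeneralLinearGroup.det (g : GL (Fin 3) (LocalRing E v)) = 1) : Ψ g = 1 := by
  classical
  have hc : c ≠ 1 := hc_of_delta E c hcδ hδ
  have hd : ∀ i, c (d i) = d i := apply_diag_eq E c d hJh
  have hd0 : ∀ i, d i ≠ 0 := diag_ne_zero E d hJdet
  letI : Field (LocalRing E v) := (LocalRing.isField_of_smul_eq c hc w hw).toField
  have hσ : ∀ x, conjLocal E c v (conjLocal E c v x) = x := LemD1OfPlace.conjLocal_conjLocal_apply E v c hcδ hδ
  have hθ : conjLocal E c v (algebraMap E (LocalRing E v) δ) = -algebraMap E (LocalRing E v) δ := by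
    rw [conjLocal_algebraMap, hcδ, map_neg]
  have hθ0 : algebraMap E (LocalRing E v) δ ≠ 0 := (_root_.map_ne_zero _).2 hδ
  have h2 : (2 : LocalRing E v) ≠ 0 := by
    rw [← map_ofNat (algebraMap E (LocalRing E v)) 2]
    exact (_root_.map_ne_zero _).2 two_ne_zero
  -- `S.U` is the tree's local unitary group of the form `J ⊗ 1 = diagonal (dᵢ ⊗ 1)`
  have hEq : (LemD1OfPlace.standingData E v c 3 (Matrix.diagonal d) hcδ hδ (by norm_num) hJh hJdet).U =
      unitaryGroupOfForm (conjLocal E c v) ((adelicForm E 3 (Matrix.diagonal d)).map (adeleToLocal E v)) :=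
    Subgroup.ext fun x => LemD1OfPlace.mem_U_iff E v c 3 (Matrix.diagonal d) hcδ hδ (by norm_num) hJh hJdet x
  have hM : (adelicForm E 3 (Matrix.diagonal d)).map (adeleToLocal E v) =
      Matrix.diagonal (fun i => algebraMap E (LocalRing E v) (d i)) := by
    rw [LemD1OfPlace.localGram_eq, Matrix.diagonal_map (map_zero _)]
  obtain ⟨x, hx0, hxx⟩ := HermitianLocal.exists_isotropic_localRing E c hc v (le_refl 3) hd
  refine kills_of_eq hEq (fun y => ((y : GL (Fin 3) (LocalRing E v)) : Matrix (Fin 3) (Fin 3) (LocalRing E v)).det = 1) ?_ Ψ g ?_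
  · intro θ' y hy
    exact UnitaryRankThree.apply_eq_one_of_det_eq_one_diagonal' (σ := conjLocal E c v) hσ hθ hθ0 h2 _
      (fun i => algebraMap E (LocalRing E v) (d i)) hM (fun i => by rw [conjLocal_algebraMap, hd])
      (fun i => (_root_.map_ne_zero _).2 (hd0 i)) ⟨x, hx0, hxx⟩ θ' y hy
  · have h := congrArg (fun u : (LocalRing E v)ˣ => (u : LocalRing E v)) hg
    simpa only [Matrix.GeneralLinearGroup.val_det_apply, Units.val_one] using h

/-- `Nat.Coprime 3 (q + 1) ↔ ¬ 3 ∣ q + 1` (`3` prime). [folklore] -/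
private theorem coprime_three_iff {q : ℕ} : Nat.Coprime 3 (q + 1) ↔ ¬ 3 ∣ q + 1 :=
  Nat.Prime.coprime_iff_not_dvd Nat.prime_three

include hcδ hJh hJdet in
/-- **Rank 3, diagonal `J`, THE PLACES OF THE CONJUNCTION: every character of `U(V)(F_v)` trivial on the centre is TRIVIAL** — at a
non-split place `w ∣ v` with `v_w(3) = 1` which is ramified over `v` or has `3 ∤ q_v + 1`, `E_v¹ = (E_v¹)³` (✔ `…DetLineDecision.forall_exists_pow_eq_iff`)
and every character kills `SU(V)(F_v)` (§1), so ✔ `…DetLineDecision.eq_one_of_forall_det_eq_one_of_forall_exists_pow_eq` concludes: NO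
one-dimensional carrier with trivial central character at all. [cite: Dieudonne1971GroupesClassiques, Chap. II §5]
[cite: Liu2021, App. D §D.1 Step 3 (l. 5221) and Lemma D.1 (3) (l. 5233)] [cite: NeukirchANT1999, Ch. II §5 Prop. (5.3)] -/
theorem eq_one_of_forall_scalar_eq_one_of_diagonal (w : PlacesOver E v) (hw : c • w.1 = w.1)
    (h3v : Valued.v ((3 : ℕ) : w.1.adicCompletion E) = 1)
    (h : v.asIdeal.ramificationIdx' w.1.asIdeal ≠ 1 ∨ ¬ 3 ∣ Nat.card (𝓞 F ⧸ v.asIdeal) + 1)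
    (Ψ : (LemD1OfPlace.standingData E v c 3 (Matrix.diagonal d) hcδ hδ (by norm_num) hJh hJdet).U →* ℂˣ)
    (hcen : ∀ z : (LemD1OfPlace.standingData E v c 3 (Matrix.diagonal d) hcδ hδ (by norm_num) hJh hJdet).normOne,
      Ψ ((LemD1OfPlace.standingData E v c 3 (Matrix.diagonal d) hcδ hδ (by norm_num) hJh hJdet).scalar z) = 1) :
    Ψ = 1 :=
  LemD1IndexedNonVacuityDetLineDecision.eq_one_of_forall_det_eq_one_of_forall_exists_pow_eq E v c hcδ hδ 3 (Matrix.diagonal d)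
    (by norm_num) hJh hJdet
    ((LemD1IndexedNonVacuityDetLineDecision.forall_exists_pow_eq_iff E v c hcδ hδ 3 (Matrix.diagonal d) (by norm_num) hJh hJdet w).2
      ⟨hw, by decide, h3v, h.imp_right coprime_three_iff.2⟩)
    Ψ (fun g hg => apply_eq_one_of_det_eq_one_of_diagonal E v c hcδ hδ d hJh hJdet w hw Ψ g hg) hcen

include hcδ hJh hJdet in
/-- **… hence two characters of `U(V)(F_v)` with the SAME central character are EQUAL there** (apply the previous theorem to `Ψ₁ Ψ₂⁻¹`):
no two-member model with LINE carriers, equal `χ`-labels and non-isomorphic carriers exists at these places — the `μ`-alone ∕ `ε`-alone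
certificates of the lineage are impossible there with ANY line carriers, not merely with det-line ones. [cite: Dieudonne1971GroupesClassiques, Chap. II §5]
[cite: Liu2021, App. D Lemma D.1 (3) (l. 5233)] -/
theorem eq_of_forall_scalar_eq_of_diagonal (w : PlacesOver E v) (hw : c • w.1 = w.1)
    (h3v : Valued.v ((3 : ℕ) : w.1.adicCompletion E) = 1)
    (h : v.asIdeal.ramificationIdx' w.1.asIdeal ≠ 1 ∨ ¬ 3 ∣ Nat.card (𝓞 F ⧸ v.asIdeal) + 1)
    (Ψ₁ Ψ₂ : (LemD1OfPlace.standingData E v c 3 (Matrix.diagonal d) hcδ hδ (by norm_num) hJh hJdet).U →* ℂˣ)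
    (h12 : ∀ z : (LemD1OfPlace.standingData E v c 3 (Matrix.diagonal d) hcδ hδ (by norm_num) hJh hJdet).normOne,
      Ψ₁ ((LemD1OfPlace.standingData E v c 3 (Matrix.diagonal d) hcδ hδ (by norm_num) hJh hJdet).scalar z) =
        Ψ₂ ((LemD1OfPlace.standingData E v c 3 (Matrix.diagonal d) hcδ hδ (by norm_num) hJh hJdet).scalar z)) :
    Ψ₁ = Ψ₂ := by
  have key := eq_one_of_forall_scalar_eq_one_of_diagonal E v c hcδ hδ d hJh hJdet w hw h3v h (Ψ₁ * Ψ₂⁻¹) fun z => by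
    rw [MonoidHom.mul_apply, MonoidHom.inv_apply, h12, mul_inv_cancel]
  exact mul_inv_eq_one.1 key

include hcδ hJh hJdet in
/-- **THE CHARACTER DECISION, rank 3, diagonal `J`, EVERY finite place**: a character of `U(V)(F_v)` trivial on the centre `E_v¹` and non-trivial
EXISTS ⟺ NOT (`c • w = w` ∧ `v_w(3) = 1` ∧ (`e(w|v) ≠ 1` ∨ `3 ∤ q_v + 1`)) — «⟸» by the det-line carriers of ✔ `…DetLineDecision.exists_detLine_carrier_of_not`
(split ∕ wild ∕ inert with `3 ∣ q_v + 1`), «⟹» by the previous theorem. [cite: Dieudonne1971GroupesClassiques, Chap. II §5]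
[cite: Liu2021, App. D §D.1 Step 3 (l. 5221) and Lemma D.1 (3) (l. 5233)] -/
theorem exists_character_trivial_on_center_iff_of_diagonal (w : PlacesOver E v) :
    (∃ Ψ : (LemD1OfPlace.standingData E v c 3 (Matrix.diagonal d) hcδ hδ (by norm_num) hJh hJdet).U →* ℂˣ,
        (∀ z : (LemD1OfPlace.standingData E v c 3 (Matrix.diagonal d) hcδ hδ (by norm_num) hJh hJdet).normOne,
          Ψ ((LemD1OfPlace.standingData E v c 3 (Matrix.diagonal d) hcδ hδ (by norm_num) hJh hJdet).scalar z) = 1) ∧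
        Ψ ≠ 1) ↔
      ¬ (c • w.1 = w.1 ∧ Valued.v ((3 : ℕ) : w.1.adicCompletion E) = 1 ∧
        (v.asIdeal.ramificationIdx' w.1.asIdeal ≠ 1 ∨ ¬ 3 ∣ Nat.card (𝓞 F ⧸ v.asIdeal) + 1)) := by
  constructor
  · rintro ⟨Ψ, hcen, hne⟩ ⟨hw, h3v, h⟩
    exact hne (eq_one_of_forall_scalar_eq_one_of_diagonal E v c hcδ hδ d hJh hJdet w hw h3v h Ψ hcen)
  · intro h
    have h' : ¬ (c • w.1 = w.1 ∧ Odd 3 ∧ Valued.v ((3 : ℕ) : w.1.adicCompletion E) = 1 ∧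
        (v.asIdeal.ramificationIdx' w.1.asIdeal ≠ 1 ∨ Nat.Coprime 3 (Nat.card (𝓞 F ⧸ v.asIdeal) + 1))) :=
      fun ⟨hw, _, h3v, hh⟩ => h ⟨hw, h3v, hh.imp_right coprime_three_iff.1⟩
    obtain ⟨Ψ, θ, -, hcen, -, ⟨g₀, hg₀⟩, -, -⟩ :=
      LemD1IndexedNonVacuityDetLineDecision.exists_detLine_carrier_of_not E v c hcδ hδ 3 (Matrix.diagonal d) (by norm_num) hJh hJdet w h'
    exact ⟨Ψ, hcen, fun h1 => hg₀ (by rw [h1, MonoidHom.one_apply])⟩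

end Diagonal

/-! ## §2–§3 The CM rows: ANY hermitian `J₃` over `L` (Landherr congruence), every finite place of `L⁺` -/

section CM

open Literature.NumberTheory.GelbartRogawski1991.UnitaryDualPair (imagUnit complexConj_imagUnit imagUnit_ne_zero)
open Literature.NumberTheory.QuadraticForms (Landherr.conjTranspose Landherr.conjTranspose_apply Landherr.exists_congr_diagonal)

variable (L : Type) [Field L] [NumberField L] [IsCMField L]

local notation3 "cc" => (IsCMField.complexConj L)
local notation3 "L⁺" => (↥(maximalRealSubfield L))

variable (v : HeightOneSpectrum (𝓞 (maximalRealSubfield L))) (J₃ : Matrix (Fin 3) (Fin 3) L)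
  (hJh₃ : (J₃.map (IsCMField.complexConj L))ᵀ = J₃) (hJdet₃ : J₃.det ≠ 0)

/-- **CM rows, ANY hermitian `J₃`, NON-SPLIT place: every character of `U(V)(L⁺_v)` kills `SU(V)(L⁺_v)`.**  Landherr's congruence
`ᵗḠ J₃ G = diag d` over `L` (✔ `Landherr.exists_congr_diagonal`), read in the field `L ⊗ L⁺_v` (✔ `LocalRing.isField_of_smul_eq`), transports
(✔ `UnitaryRankThree.apply_eq_one_of_det_eq_one_of_formCongr`) the diagonal rank-3 engine (✔ `UnitaryRankThree.apply_eq_one_of_det_eq_one_diagonal`,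
isotropy ✔ `HermitianLocal.exists_isotropic_localRing`) to `S.U`. [cite: Dieudonne1971GroupesClassiques, Chap. II §5]
[cite: Landherr1936HermitianForms] [cite: Jacobson1940HermitianForms, §3 (1)(a)] [cite: Liu2021, App. D §D.1 Step 3 (l. 5221)] -/
theorem apply_eq_one_of_det_eq_one_of_isCMField (w : PlacesOver L v) (hw : cc • w.1 = w.1)
    (Ψ : (LemD1OfPlace.standingData L v cc 3 J₃ (complexConj_imagUnit L) (imagUnit_ne_zero L) (by norm_num) hJh₃ hJdet₃).U →* ℂˣ)
    (g : (LemD1OfPlace.standingData L v cc 3 J₃ (complexConj_imagUnit L) (imagUnit_ne_zero L) (by norm_num) hJh₃ hJdet₃).U)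
    (hg : Matrix.GeneralLinearGroup.det (g : GL (Fin 3) (LocalRing L v)) = 1) : Ψ g = 1 := by
  classical
  have hc : cc ≠ 1 := IsCMField.complexConj_ne_one L
  have hσ : ∀ x, conjLocal L cc v (conjLocal L cc v x) = x :=
    LemD1OfPlace.conjLocal_conjLocal_apply L v cc (complexConj_imagUnit L) (imagUnit_ne_zero L)
  have hθ : conjLocal L cc v (algebraMap L (LocalRing L v) (imagUnit L)) = -algebraMap L (LocalRing L v) (imagUnit L) := by
    rw [conjLocal_algebraMap, complexConj_imagUnit L, map_neg]
  have hθ0 : algebraMap L (LocalRing L v) (imagUnit L) ≠ 0 := (_root_.map_ne_zero _).2 (imagUnit_ne_zero L)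
  have h2 : (2 : LocalRing L v) ≠ 0 := by
    rw [← map_ofNat (algebraMap L (LocalRing L v)) 2]
    exact (_root_.map_ne_zero _).2 two_ne_zero
  have hcomp : ∀ y : L, conjLocal L cc v (algebraMap L (LocalRing L v) y) = algebraMap L (LocalRing L v) (IsCMField.complexConj L y) :=
    fun y => conjLocal_algebraMap cc v y
  -- Landherr's congruence over `L`
  have hJh' : Landherr.conjTranspose L J₃ = J₃ := by
    change (J₃ᵀ).map (IsCMField.complexConj L) = J₃
    rw [Matrix.transpose_map]
    exact hJh₃
  obtain ⟨G, hG, d, hd, hd0, hcong⟩ := Landherr.exists_congr_diagonal L J₃ hJh' hJdet₃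
  -- read in `K = L ⊗ L⁺_v`
  have hGφ : IsUnit (G.map (algebraMap L (LocalRing L v))) := by
    rw [Matrix.isUnit_iff_isUnit_det, ← RingHom.mapMatrix_apply, ← RingHom.map_det]
    exact hG.map _
  let T : GL (Fin 3) (LocalRing L v) := hGφ.unit
  have hT : T.1 = G.map (algebraMap L (LocalRing L v)) := hGφ.unit_spec
  have hM : (adelicForm L 3 J₃).map (adeleToLocal L v) = J₃.map (algebraMap L (LocalRing L v)) :=
    LemD1OfPlace.localGram_eq L v 3 J₃
  have hA : (T.1.map (conjLocal L cc v))ᵀ = (Landherr.conjTranspose L G).map (algebraMap L (LocalRing L v)) := by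
    rw [hT]
    ext i j
    simp only [Matrix.transpose_apply, Matrix.map_apply, Landherr.conjTranspose_apply, hcomp]
  have hcongr : formCongr (conjLocal L cc v) T ((adelicForm L 3 J₃).map (adeleToLocal L v)) =
      Matrix.diagonal (fun i => algebraMap L (LocalRing L v) (d i)) := by
    change (T.1.map (conjLocal L cc v))ᵀ * _ * T.1 = _
    rw [hA, hM, hT, ← Matrix.map_mul, ← Matrix.map_mul, hcong, Matrix.diagonal_map (map_zero _)]
  -- `S.U` is the tree's local unitary group of `J₃ ⊗ 1`
  have hEq : (LemD1OfPlace.standingData L v cc 3 J₃ (complexConj_imagUnit L) (imagUnit_ne_zero L) (by norm_num) hJh₃ hJdet₃).U =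
      unitaryGroupOfForm (conjLocal L cc v) ((adelicForm L 3 J₃).map (adeleToLocal L v)) :=
    Subgroup.ext fun x => LemD1OfPlace.mem_U_iff L v cc 3 J₃ (complexConj_imagUnit L) (imagUnit_ne_zero L) (by norm_num) hJh₃ hJdet₃ x
  obtain ⟨x, hx0, hxx⟩ := HermitianLocal.exists_isotropic_localRing L cc hc v (le_refl 3) hd
  letI : Field (LocalRing L v) := (LocalRing.isField_of_smul_eq cc hc w hw).toField
  refine kills_of_eq hEq (fun y => ((y : GL (Fin 3) (LocalRing L v)) : Matrix (Fin 3) (Fin 3) (LocalRing L v)).det = 1) ?_ Ψ g ?_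
  · intro θ' y hy
    refine UnitaryRankThree.apply_eq_one_of_det_eq_one_of_formCongr T _ _ hcongr (fun χ' g' h' => ?_) θ' y hy
    exact UnitaryRankThree.apply_eq_one_of_det_eq_one_diagonal (σ := conjLocal L cc v) hσ hθ hθ0 h2
      (fun i => algebraMap L (LocalRing L v) (d i)) (fun i => by rw [hcomp, hd]) (fun i => (_root_.map_ne_zero _).2 (hd0 i))
      ⟨x, hx0, hxx⟩ χ' g' h'
  · have h := congrArg (fun u : (LocalRing L v)ˣ => (u : LocalRing L v)) hg
    simpa only [Matrix.GeneralLinearGroup.val_det_apply, Units.val_one] using h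

/-- **CM rows, THE PLACES OF THE CONJUNCTION: every character of `U(V)(L⁺_v)` trivial on the centre is TRIVIAL** (ANY hermitian `J₃`): at a
non-split `w ∤ 3` of `L` which is ramified over `L⁺` or has `3 ∤ q_v + 1` there is NO one-dimensional carrier with trivial central character
at all. [cite: Dieudonne1971GroupesClassiques, Chap. II §5] [cite: Liu2021, App. D Lemma D.1 (3) (l. 5233)] [cite: NeukirchANT1999, Ch. II §5 Prop. (5.3)] -/
theorem eq_one_of_forall_scalar_eq_one_of_isCMField (w : PlacesOver L v) (hw : cc • w.1 = w.1)
    (h3v : Valued.v ((3 : ℕ) : w.1.adicCompletion L) = 1)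
    (h : v.asIdeal.ramificationIdx' w.1.asIdeal ≠ 1 ∨ ¬ 3 ∣ Nat.card (𝓞 L⁺ ⧸ v.asIdeal) + 1)
    (Ψ : (LemD1OfPlace.standingData L v cc 3 J₃ (complexConj_imagUnit L) (imagUnit_ne_zero L) (by norm_num) hJh₃ hJdet₃).U →* ℂˣ)
    (hcen : ∀ z : (LemD1OfPlace.standingData L v cc 3 J₃ (complexConj_imagUnit L) (imagUnit_ne_zero L) (by norm_num) hJh₃ hJdet₃).normOne,
      Ψ ((LemD1OfPlace.standingData L v cc 3 J₃ (complexConj_imagUnit L) (imagUnit_ne_zero L) (by norm_num) hJh₃ hJdet₃).scalar z) = 1) :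
    Ψ = 1 :=
  LemD1IndexedNonVacuityDetLineDecision.eq_one_of_forall_det_eq_one_of_forall_exists_pow_eq L v cc (complexConj_imagUnit L)
    (imagUnit_ne_zero L) 3 J₃ (by norm_num) hJh₃ hJdet₃
    ((LemD1IndexedNonVacuityDetLineDecision.forall_exists_pow_eq_iff L v cc (complexConj_imagUnit L) (imagUnit_ne_zero L) 3 J₃
      (by norm_num) hJh₃ hJdet₃ w).2 ⟨hw, by decide, h3v, h.imp_right coprime_three_iff.2⟩)
    Ψ (fun g hg => apply_eq_one_of_det_eq_one_of_isCMField L v J₃ hJh₃ hJdet₃ w hw Ψ g hg) hcen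

/-- **CM rows: two characters of `U(V)(L⁺_v)` with the same central character are EQUAL at the places of the conjunction** — no
`μ`-alone ∕ `ε`-alone two-member model with ANY line carriers exists there. [cite: Dieudonne1971GroupesClassiques, Chap. II §5]
[cite: Liu2021, App. D Lemma D.1 (3) (l. 5233)] -/
theorem eq_of_forall_scalar_eq_of_isCMField (w : PlacesOver L v) (hw : cc • w.1 = w.1)
    (h3v : Valued.v ((3 : ℕ) : w.1.adicCompletion L) = 1)
    (h : v.asIdeal.ramificationIdx' w.1.asIdeal ≠ 1 ∨ ¬ 3 ∣ Nat.card (𝓞 L⁺ ⧸ v.asIdeal) + 1)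
    (Ψ₁ Ψ₂ : (LemD1OfPlace.standingData L v cc 3 J₃ (complexConj_imagUnit L) (imagUnit_ne_zero L) (by norm_num) hJh₃ hJdet₃).U →* ℂˣ)
    (h12 : ∀ z : (LemD1OfPlace.standingData L v cc 3 J₃ (complexConj_imagUnit L) (imagUnit_ne_zero L) (by norm_num) hJh₃ hJdet₃).normOne,
      Ψ₁ ((LemD1OfPlace.standingData L v cc 3 J₃ (complexConj_imagUnit L) (imagUnit_ne_zero L) (by norm_num) hJh₃ hJdet₃).scalar z) =
        Ψ₂ ((LemD1OfPlace.standingData L v cc 3 J₃ (complexConj_imagUnit L) (imagUnit_ne_zero L) (by norm_num) hJh₃ hJdet₃).scalar z)) :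
    Ψ₁ = Ψ₂ := by
  have key := eq_one_of_forall_scalar_eq_one_of_isCMField L v J₃ hJh₃ hJdet₃ w hw h3v h (Ψ₁ * Ψ₂⁻¹) fun z => by
    rw [MonoidHom.mul_apply, MonoidHom.inv_apply, h12, mul_inv_cancel]
  exact mul_inv_eq_one.1 key

/-- **THE CHARACTER DECISION FOR THE END's RANK 3** (ANY CM field `L`, ANY hermitian non-degenerate `J₃`, EVERY finite place `w ∣ v` of `L`):
a character of `U(V)(L⁺_v)` trivial on the centre and non-trivial EXISTS ⟺ NOT (`\bar w = w` ∧ `v_w(3) = 1` ∧ (`e(w|v) ≠ 1` ∨ `3 ∤ q_v + 1`)),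
i.e. iff `w` is split, or `w ∣ 3`, or `w` is inert with `q_v ≡ 2 (mod 3)` — and then a det-line one exists (✔ `…DetLineDecision`).  The
lineage's det-line picture IS the full one-dimensional picture. [cite: Dieudonne1971GroupesClassiques, Chap. II §5]
[cite: Liu2021, App. D §D.1 Step 3 (l. 5221) and Lemma D.1 (3) (l. 5233)] -/
theorem exists_character_trivial_on_center_iff_of_isCMField (w : PlacesOver L v) :
    (∃ Ψ : (LemD1OfPlace.standingData L v cc 3 J₃ (complexConj_imagUnit L) (imagUnit_ne_zero L) (by norm_num) hJh₃ hJdet₃).U →* ℂˣ,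
        (∀ z : (LemD1OfPlace.standingData L v cc 3 J₃ (complexConj_imagUnit L) (imagUnit_ne_zero L) (by norm_num) hJh₃ hJdet₃).normOne,
          Ψ ((LemD1OfPlace.standingData L v cc 3 J₃ (complexConj_imagUnit L) (imagUnit_ne_zero L) (by norm_num) hJh₃ hJdet₃).scalar z) = 1) ∧
        Ψ ≠ 1) ↔
      ¬ (cc • w.1 = w.1 ∧ Valued.v ((3 : ℕ) : w.1.adicCompletion L) = 1 ∧
        (v.asIdeal.ramificationIdx' w.1.asIdeal ≠ 1 ∨ ¬ 3 ∣ Nat.card (𝓞 L⁺ ⧸ v.asIdeal) + 1)) := by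
  constructor
  · rintro ⟨Ψ, hcen, hne⟩ ⟨hw, h3v, h⟩
    exact hne (eq_one_of_forall_scalar_eq_one_of_isCMField L v J₃ hJh₃ hJdet₃ w hw h3v h Ψ hcen)
  · intro h
    have h' : ¬ (cc • w.1 = w.1 ∧ Odd 3 ∧ Valued.v ((3 : ℕ) : w.1.adicCompletion L) = 1 ∧
        (v.asIdeal.ramificationIdx' w.1.asIdeal ≠ 1 ∨ Nat.Coprime 3 (Nat.card (𝓞 L⁺ ⧸ v.asIdeal) + 1))) :=
      fun ⟨hw, _, h3v, hh⟩ => h ⟨hw, h3v, hh.imp_right coprime_three_iff.1⟩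
    obtain ⟨Ψ, θ, -, hcen, -, ⟨g₀, hg₀⟩, -, -⟩ :=
      LemD1IndexedNonVacuityDetLineDecision.exists_detLine_carrier_of_not L v cc (complexConj_imagUnit L) (imagUnit_ne_zero L) 3 J₃
        (by norm_num) hJh₃ hJdet₃ w h'
    exact ⟨Ψ, hcen, fun h1 => hg₀ (by rw [h1, MonoidHom.one_apply])⟩

end CM

/-! # v2 (APPEND-only): LINE-carrier collections COLLAPSE at the places of the conjunction

The positive counterpart of the lineage's non-vacuity certificates: at every place carrying a centre-trivial det-line character the certificates
(✔ `…DetCarrier`, `…WildCarrier`, `…InertCarrier`, `…DetLineDecision` §3, …) exhibit two-member collections with LINE carriers satisfying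
[Lem. D.1, first sentence + (1)] and [Lem. D.1 (3)] AS PRINTED in which «same `ε`-class ∧ same `χ` ⟹ same `μ`» FAILS; at the remaining places of the
END's rank `3` (§1–§3 above: characters are determined by their central character) the records read on LINE-carrier collections FORCE
«same `χ` ⟹ same `μ` ∧ same `ε`-class» — vacuous-by-collapse:

* §4 `apply_scalar_eq_chi_of_item1_of_lineCarrier` (any standing data, rank `≥ 3`): a LINE carrier (`U(V)(F)` acting on `V_k ≃ ℂ` through a character
  `λ_k`) satisfying item (1) has `λ_k ∘ S.scalar = χ_k` (else the `χ_k`-augmentation is everything and `ω(μ_k, ε_k, χ_k) = 0`), its augmentation is `⊥`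
  (`augmentation_eq_bot_of_item1_of_lineCarrier`), and two line carriers with the SAME character have isomorphic `ω`'s (`areIsomorphicRep_of_lineCarriers_of_eq`);
* §5 the CM rows, ANY `J₃`: `areIsomorphicRep_of_chi_eq_of_lineCarriers_of_isCMField`, `mu_eq_and_sameClass_of_chi_eq_of_lineCarriers_of_isCMField`,
  `forall_mu_eq_of_chi_eq_of_lineCarriers_of_isCMField`; §6 diagonal `J`, any `E/F`: `forall_mu_eq_of_chi_eq_of_lineCarriers_of_diagonal`.
[cite: Liu2021, App. D Lemma D.1 (1) and (3) (l. 5229, 5233)] [cite: Dieudonne1971GroupesClassiques, Chap. II §5] -/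

open Literature.RepresentationTheory.CentralCharacterQuotient (augmentation quotRep quotRep_mk sub_smul_mem_augmentation)

/-! ## §4 (v2) A LINE carrier satisfying item (1) acts on the centre through its `χ`-label (any standing data, rank `≥ 3`) -/

section Abstract

variable {F₀ E₀ : Type} [Field F₀] [ValuativeRel F₀] [TopologicalSpace F₀] [CommRing E₀] [Algebra F₀ E₀] [TopologicalSpace E₀]
  [IsTopologicalRing E₀] {n : ℕ} {ι : Type}

/-- **a LINE carrier satisfying [Lem. D.1 (1)] AS PRINTED (rank `n ≥ 3`) acts on the centre through its `χ`-label**: if `U(V)(F)` acts on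
`V_k ≃ ℂ` through a character `λ_k` and `ω(μ_k, ε_k, χ_k) ≠ 0` (item (1) for `n ≠ 2`), then `λ_k(z · 1_N) = χ_k(z)` for every `z ∈ E¹`
(if `λ_k(z₀ · 1) ≠ χ_k(z₀)` the generator `ω(z₀ · 1) − χ_k(z₀)` of the augmentation is an invertible scalar, so the `χ_k`-quotient is `0`).
[cite: Liu2021, App. D Lemma D.1 (1) (l. 5229) and §D.1 Step 3 (l. 5221)] -/
theorem apply_scalar_eq_chi_of_item1_of_lineCarrier (Lf : LemD1IndexedFamily F₀ E₀ n ι) (hn : 3 ≤ n) (h1 : Lf.Item1AsPrinted)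
    (k : ι) (lam : Lf.S.U →* ℂˣ) (e : Lf.V k ≃ₗ[ℂ] ℂ) (hlam : ∀ (g : Lf.S.U) (x : Lf.V k), e (Lf.omega k g x) = (lam g : ℂ) * e x)
    (z : Lf.S.normOne) : lam (Lf.S.scalar z) = (Lf.chi k).1 z := by
  have hω : ∀ (g : Lf.S.U) (x : Lf.V k), Lf.omega k g x = ((lam g : ℂˣ) : ℂ) • x := fun g x =>
    e.injective (by rw [hlam, map_smul, smul_eq_mul])
  by_contra hne
  have hc : ((lam (Lf.S.scalar z) : ℂˣ) : ℂ) - (((Lf.chi k).1 z : ℂˣ) : ℂ) ≠ 0 :=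
    fun h => hne (Units.ext (sub_eq_zero.1 h))
  -- the augmentation is everything
  have htop : ∀ x : Lf.V k, x ∈ augmentation (Lf.omega k) Lf.S.scalar (Lf.chi k).1 := fun x => by
    have hmem := sub_smul_mem_augmentation (Lf.omega k) Lf.S.scalar (Lf.chi k).1 z
      ((((lam (Lf.S.scalar z) : ℂˣ) : ℂ) - (((Lf.chi k).1 z : ℂˣ) : ℂ))⁻¹ • x)
    rwa [hω, smul_smul, smul_smul, ← sub_smul, ← sub_mul, mul_inv_cancel₀ hc, one_smul] at hmem
  haveI := h1.nontrivial_of_three_le hn k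
  obtain ⟨q, hq⟩ := exists_ne (0 : Lf.V k ⧸ augmentation (Lf.omega k) Lf.S.scalar (Lf.chi k).1)
  obtain ⟨x, rfl⟩ := Submodule.Quotient.mk_surjective _ q
  exact hq ((Submodule.Quotient.mk_eq_zero _).2 (htop x))

/-- **… so its `χ`-augmentation vanishes**: `ω(μ_k, ε_k, χ_k)` is the line `V_k` itself. [cite: Liu2021, App. D Lemma D.1 (1) (l. 5229)] -/
theorem augmentation_eq_bot_of_item1_of_lineCarrier (Lf : LemD1IndexedFamily F₀ E₀ n ι) (hn : 3 ≤ n) (h1 : Lf.Item1AsPrinted)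
    (k : ι) (lam : Lf.S.U →* ℂˣ) (e : Lf.V k ≃ₗ[ℂ] ℂ) (hlam : ∀ (g : Lf.S.U) (x : Lf.V k), e (Lf.omega k g x) = (lam g : ℂ) * e x) :
    augmentation (Lf.omega k) Lf.S.scalar (Lf.chi k).1 = ⊥ := by
  have hω : ∀ (g : Lf.S.U) (x : Lf.V k), Lf.omega k g x = ((lam g : ℂˣ) : ℂ) • x := fun g x =>
    e.injective (by rw [hlam, map_smul, smul_eq_mul])
  have hcen := apply_scalar_eq_chi_of_item1_of_lineCarrier Lf hn h1 k lam e hlam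
  unfold augmentation
  refine iSup_eq_bot.2 fun z => ?_
  rw [LinearMap.range_eq_bot]
  ext x
  rw [LinearMap.sub_apply, LinearMap.smul_apply, LinearMap.id_apply, hω, hcen, sub_self, LinearMap.zero_apply]

/-- **two LINE-carrier members with the SAME character have ISOMORPHIC `ω(μ, ε, χ)`'s** (item (1) for both; rank `≥ 3`): both
quotients are the lines themselves, and `e_i⁻¹ ∘ e_j` intertwines. [cite: Liu2021, App. D Lemma D.1 (1) (l. 5229) and (3) (l. 5233)] -/
theorem areIsomorphicRep_of_lineCarriers_of_eq (Lf : LemD1IndexedFamily F₀ E₀ n ι) (hn : 3 ≤ n) (h1 : Lf.Item1AsPrinted)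
    {i j : ι} (lam : Lf.S.U →* ℂˣ) (eᵢ : Lf.V i ≃ₗ[ℂ] ℂ) (hi : ∀ (g : Lf.S.U) (x : Lf.V i), eᵢ (Lf.omega i g x) = (lam g : ℂ) * eᵢ x)
    (eⱼ : Lf.V j ≃ₗ[ℂ] ℂ) (hj : ∀ (g : Lf.S.U) (x : Lf.V j), eⱼ (Lf.omega j g x) = (lam g : ℂ) * eⱼ x) :
    AreIsomorphicRep (Lf.quot j) (Lf.quot i) := by
  have hωi : ∀ (g : Lf.S.U) (x : Lf.V i), Lf.omega i g x = ((lam g : ℂˣ) : ℂ) • x := fun g x =>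
    eᵢ.injective (by rw [hi, map_smul, smul_eq_mul])
  have hωj : ∀ (g : Lf.S.U) (x : Lf.V j), Lf.omega j g x = ((lam g : ℂˣ) : ℂ) • x := fun g x =>
    eⱼ.injective (by rw [hj, map_smul, smul_eq_mul])
  have hbi := augmentation_eq_bot_of_item1_of_lineCarrier Lf hn h1 i lam eᵢ hi
  have hbj := augmentation_eq_bot_of_item1_of_lineCarrier Lf hn h1 j lam eⱼ hj
  refine ⟨(Submodule.quotEquivOfEqBot _ hbj).trans (eⱼ.trans (eᵢ.symm.trans (Submodule.quotEquivOfEqBot _ hbi).symm)), fun g q => ?_⟩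
  obtain ⟨y, rfl⟩ := Submodule.Quotient.mk_surjective _ q
  have hqj : Lf.quot j g (Submodule.Quotient.mk y) =
      (Submodule.Quotient.mk (Lf.omega j g y) : Lf.V j ⧸ augmentation (Lf.omega j) Lf.S.scalar (Lf.chi j).1) :=
    quotRep_mk (Lf.omega j) Lf.S.scalar_mem_center (Lf.chi j).1 g y
  have hqi : ∀ u : Lf.V i, Lf.quot i g (Submodule.Quotient.mk u) =
      (Submodule.Quotient.mk (Lf.omega i g u) : Lf.V i ⧸ augmentation (Lf.omega i) Lf.S.scalar (Lf.chi i).1) :=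
    fun u => quotRep_mk (Lf.omega i) Lf.S.scalar_mem_center (Lf.chi i).1 g u
  rw [hqj]
  simp only [LinearEquiv.trans_apply, Submodule.quotEquivOfEqBot_apply_mk, Submodule.quotEquivOfEqBot_symm_apply, hqi, hωi,
    hωj, map_smul, Submodule.Quotient.mk_smul]

end Abstract

/-! ## §5 (v2) The CM rows, rank `3`, ANY hermitian `J₃`: at the places of the conjunction LINE-carrier collections collapse -/

section CM

open Literature.NumberTheory.GelbartRogawski1991.UnitaryDualPair (imagUnit complexConj_imagUnit imagUnit_ne_zero)

variable (L : Type) [Field L] [NumberField L] [IsCMField L]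

local notation3 "cc" => (IsCMField.complexConj L)
local notation3 "L⁺" => (↥(maximalRealSubfield L))

variable (v : HeightOneSpectrum (𝓞 (maximalRealSubfield L))) (J₃ : Matrix (Fin 3) (Fin 3) L)
  (hJh₃ : (J₃.map (IsCMField.complexConj L))ᵀ = J₃) (hJdet₃ : J₃.det ≠ 0)

/-- **At a place of the conjunction two LINE-carrier members with the same `χ`-label have ISOMORPHIC `ω(μ, ε, χ)`'s** (CM rows, any
hermitian `J₃`; `\bar w = w`, `v_w(3) = 1`, `e(w|v) ≠ 1` or `3 ∤ q_v + 1`; item (1) for the collection): both carriers act on the centre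
through `χ_i = χ_j` (§1), so the two characters of `U(V)(L⁺_v)` coincide (✔ `…CharacterDecision.eq_of_forall_scalar_eq_of_isCMField`) and
the lines are isomorphic. [cite: Dieudonne1971GroupesClassiques, Chap. II §5] [cite: Liu2021, App. D Lemma D.1 (1) and (3) (l. 5229, 5233)] -/
theorem areIsomorphicRep_of_chi_eq_of_lineCarriers_of_isCMField (w : PlacesOver L v) (hw : cc • w.1 = w.1)
    (h3v : Valued.v ((3 : ℕ) : w.1.adicCompletion L) = 1)
    (h : v.asIdeal.ramificationIdx' w.1.asIdeal ≠ 1 ∨ ¬ 3 ∣ Nat.card (𝓞 L⁺ ⧸ v.asIdeal) + 1)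
    {ι : Type} (Lf : LemD1IndexedFamily (v.adicCompletion L⁺) (LocalRing L v) 3 ι)
    (hS : Lf.S = LemD1OfPlace.standingData L v cc 3 J₃ (complexConj_imagUnit L) (imagUnit_ne_zero L) (by norm_num) hJh₃ hJdet₃)
    (h1 : Lf.Item1AsPrinted) {i j : ι}
    (lamᵢ : Lf.S.U →* ℂˣ) (eᵢ : Lf.V i ≃ₗ[ℂ] ℂ) (hi : ∀ (g : Lf.S.U) (x : Lf.V i), eᵢ (Lf.omega i g x) = (lamᵢ g : ℂ) * eᵢ x)
    (lamⱼ : Lf.S.U →* ℂˣ) (eⱼ : Lf.V j ≃ₗ[ℂ] ℂ) (hj : ∀ (g : Lf.S.U) (x : Lf.V j), eⱼ (Lf.omega j g x) = (lamⱼ g : ℂ) * eⱼ x)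
    (hχ : Lf.chi j = Lf.chi i) : AreIsomorphicRep (Lf.quot j) (Lf.quot i) := by
  have hci := apply_scalar_eq_chi_of_item1_of_lineCarrier Lf le_rfl h1 i lamᵢ eᵢ hi
  have hcj := apply_scalar_eq_chi_of_item1_of_lineCarrier Lf le_rfl h1 j lamⱼ eⱼ hj
  have hχ' : (Lf.chi j).1 = (Lf.chi i).1 := congrArg Subtype.val hχ
  -- the two characters agree on the centre, hence are equal at a place of the conjunction
  have hlam : lamᵢ = lamⱼ := by
    cases Lf
    dsimp only at hS
    subst hS
    exact eq_of_forall_scalar_eq_of_isCMField L v J₃ hJh₃ hJdet₃ w hw h3v h lamᵢ lamⱼ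
      fun z => by rw [hci z, hcj z, hχ']
  subst hlam
  exact areIsomorphicRep_of_lineCarriers_of_eq Lf le_rfl h1 lamᵢ eᵢ hi eⱼ hj

/-- **… so under [Lem. D.1 (3)] AS PRINTED they have the same `μ` and the same `ε`-class**: at the places of the conjunction the records
read on LINE-carrier collections FORCE «same `χ` ⟹ same `μ` ∧ same `ε`-class» — vacuous-by-collapse, in contrast with every other finite
place of `L⁺` (✔ `…DetLineDecision` §3 ∕ ✔ `…DetCarrier` ∕ `…WildCarrier` ∕ `…InertCarrier`: two-member line-carrier certificates with
equal `ε`, equal `χ`, different `μ`). [cite: Liu2021, App. D Lemma D.1 (1) and (3) (l. 5229, 5233)] [cite: Dieudonne1971GroupesClassiques, Chap. II §5] -/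
theorem mu_eq_and_sameClass_of_chi_eq_of_lineCarriers_of_isCMField (w : PlacesOver L v) (hw : cc • w.1 = w.1)
    (h3v : Valued.v ((3 : ℕ) : w.1.adicCompletion L) = 1)
    (h : v.asIdeal.ramificationIdx' w.1.asIdeal ≠ 1 ∨ ¬ 3 ∣ Nat.card (𝓞 L⁺ ⧸ v.asIdeal) + 1)
    {ι : Type} (Lf : LemD1IndexedFamily (v.adicCompletion L⁺) (LocalRing L v) 3 ι)
    (hS : Lf.S = LemD1OfPlace.standingData L v cc 3 J₃ (complexConj_imagUnit L) (imagUnit_ne_zero L) (by norm_num) hJh₃ hJdet₃)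
    (h1 : Lf.Item1AsPrinted) (h3 : LemD1_3AsPrintedI Lf) {i j : ι}
    (lamᵢ : Lf.S.U →* ℂˣ) (eᵢ : Lf.V i ≃ₗ[ℂ] ℂ) (hi : ∀ (g : Lf.S.U) (x : Lf.V i), eᵢ (Lf.omega i g x) = (lamᵢ g : ℂ) * eᵢ x)
    (lamⱼ : Lf.S.U →* ℂˣ) (eⱼ : Lf.V j ≃ₗ[ℂ] ℂ) (hj : ∀ (g : Lf.S.U) (x : Lf.V j), eⱼ (Lf.omega j g x) = (lamⱼ g : ℂ) * eⱼ x)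
    (hχ : Lf.chi j = Lf.chi i) : Lf.mu j = Lf.mu i ∧ LemD1.SameClass (Lf.eps i) (Lf.eps j) := by
  have hiso := areIsomorphicRep_of_chi_eq_of_lineCarriers_of_isCMField L v J₃ hJh₃ hJdet₃ w hw h3v h Lf hS h1 lamᵢ eᵢ hi lamⱼ eⱼ
    hj hχ
  exact ⟨h3.mu_eq_of_areIsomorphicRep le_rfl hiso, (h3.sameClass_and_chi_eq_of_areIsomorphicRep le_rfl hiso).1⟩

/-- **Headline form**: at a place of the conjunction, for EVERY indexed collection over the rows' rank-3 place model all of whose carriers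
are LINES and which satisfies [Lem. D.1, first sentence + (1)] and [Lem. D.1 (3)] AS PRINTED, members with equal `χ`-labels have equal
`μ`-labels and `ε`-representatives in the same class. [cite: Liu2021, App. D Lemma D.1 (1) and (3) (l. 5229, 5233)]
[cite: Dieudonne1971GroupesClassiques, Chap. II §5] -/
theorem forall_mu_eq_of_chi_eq_of_lineCarriers_of_isCMField (w : PlacesOver L v) (hw : cc • w.1 = w.1)
    (h3v : Valued.v ((3 : ℕ) : w.1.adicCompletion L) = 1)
    (h : v.asIdeal.ramificationIdx' w.1.asIdeal ≠ 1 ∨ ¬ 3 ∣ Nat.card (𝓞 L⁺ ⧸ v.asIdeal) + 1)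
    {ι : Type} (Lf : LemD1IndexedFamily (v.adicCompletion L⁺) (LocalRing L v) 3 ι)
    (hS : Lf.S = LemD1OfPlace.standingData L v cc 3 J₃ (complexConj_imagUnit L) (imagUnit_ne_zero L) (by norm_num) hJh₃ hJdet₃)
    (h1 : Lf.Item1AsPrinted) (h3 : LemD1_3AsPrintedI Lf)
    (hline : ∀ k : ι, ∃ (lam : Lf.S.U →* ℂˣ) (e : Lf.V k ≃ₗ[ℂ] ℂ), ∀ (g : Lf.S.U) (x : Lf.V k), e (Lf.omega k g x) = (lam g : ℂ) * e x) :
    ∀ i j : ι, Lf.chi j = Lf.chi i → Lf.mu j = Lf.mu i ∧ LemD1.SameClass (Lf.eps i) (Lf.eps j) := fun i j hχ => by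
  obtain ⟨lamᵢ, eᵢ, hi⟩ := hline i
  obtain ⟨lamⱼ, eⱼ, hj⟩ := hline j
  exact mu_eq_and_sameClass_of_chi_eq_of_lineCarriers_of_isCMField L v J₃ hJh₃ hJdet₃ w hw h3v h Lf hS h1 h3 lamᵢ eᵢ hi lamⱼ eⱼ hj hχ

end CM

/-! ## §6 (v2) ANY quadratic `E/F`, diagonal `J` of rank `3`: the same collapse -/

section Diagonal

variable {F : Type} (E : Type) [Field F] [NumberField F] [Field E] [NumberField E] [Algebra F E]
  [Algebra.IsQuadraticExtension F E] (v : HeightOneSpectrum (𝓞 F)) (c : E ≃ₐ[F] E)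
  {δ : E} (hcδ : c δ = -δ) (hδ : δ ≠ 0)
  (d : Fin 3 → E) (hJh : ((Matrix.diagonal d).map c)ᵀ = Matrix.diagonal d) (hJdet : (Matrix.diagonal d).det ≠ 0)

include hcδ hJh hJdet in
/-- **Diagonal `J`, any `E/F`**: at a place of the conjunction, LINE-carrier collections over the rank-3 place model satisfying (1) and (3)
AS PRINTED collapse — equal `χ` forces equal `μ` and the same `ε`-class (✔ `…CharacterDecision.eq_of_forall_scalar_eq_of_diagonal`).
[cite: Liu2021, App. D Lemma D.1 (1) and (3) (l. 5229, 5233)] [cite: Dieudonne1971GroupesClassiques, Chap. II §5] -/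
theorem forall_mu_eq_of_chi_eq_of_lineCarriers_of_diagonal (w : PlacesOver E v) (hw : c • w.1 = w.1)
    (h3v : Valued.v ((3 : ℕ) : w.1.adicCompletion E) = 1)
    (h : v.asIdeal.ramificationIdx' w.1.asIdeal ≠ 1 ∨ ¬ 3 ∣ Nat.card (𝓞 F ⧸ v.asIdeal) + 1)
    {ι : Type} (Lf : LemD1IndexedFamily (v.adicCompletion F) (LocalRing E v) 3 ι)
    (hS : Lf.S = LemD1OfPlace.standingData E v c 3 (Matrix.diagonal d) hcδ hδ (by norm_num) hJh hJdet)
    (h1 : Lf.Item1AsPrinted) (h3 : LemD1_3AsPrintedI Lf)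
    (hline : ∀ k : ι, ∃ (lam : Lf.S.U →* ℂˣ) (e : Lf.V k ≃ₗ[ℂ] ℂ), ∀ (g : Lf.S.U) (x : Lf.V k), e (Lf.omega k g x) = (lam g : ℂ) * e x) :
    ∀ i j : ι, Lf.chi j = Lf.chi i → Lf.mu j = Lf.mu i ∧ LemD1.SameClass (Lf.eps i) (Lf.eps j) := fun i j hχ => by
  obtain ⟨lamᵢ, eᵢ, hi⟩ := hline i
  obtain ⟨lamⱼ, eⱼ, hj⟩ := hline j
  have hci := apply_scalar_eq_chi_of_item1_of_lineCarrier Lf le_rfl h1 i lamᵢ eᵢ hi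
  have hcj := apply_scalar_eq_chi_of_item1_of_lineCarrier Lf le_rfl h1 j lamⱼ eⱼ hj
  have hχ' : (Lf.chi j).1 = (Lf.chi i).1 := congrArg Subtype.val hχ
  have hlam : lamᵢ = lamⱼ := by
    cases Lf
    dsimp only at hS
    subst hS
    exact eq_of_forall_scalar_eq_of_diagonal E v c hcδ hδ d hJh hJdet w hw h3v h lamᵢ lamⱼ
      fun z => by rw [hci z, hcj z, hχ']
  subst hlam
  have hiso := areIsomorphicRep_of_lineCarriers_of_eq Lf le_rfl h1 lamᵢ eᵢ hi eⱼ hj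
  exact ⟨h3.mu_eq_of_areIsomorphicRep le_rfl hiso, (h3.sameClass_and_chi_eq_of_areIsomorphicRep le_rfl hiso).1⟩

end Diagonal

end Literature.NumberTheory.Automorphic.Liu2021.LemD1IndexedNonVacuityCharacterDecision

end
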